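import Summits.QuantumFields.YangMills.Theorems.BalabanUVNodesN15PerCubeGreenRows
import Summits.QuantumFields.YangMills.Theorems.BalabanUVNodesN15TwoSpacingGluingSopLocality
import Summits.QuantumFields.YangMills.Theorems.BalabanUVNodesN15TwoSpacingGluingNonlocal
import HarnessLib

/-!
# N15 = NE2, road (c) — PROGRAMME (PC), (PC-B): THE FLAT LOCAL MODEL OF THE PER-CUBE EXPANSION OF `(Q′G′²Q′ᵀ)⁻¹(U)` — in the cube's gauge the local parametrix is `S(𝟙)⁻¹M_χ`; its cut row,
# its commutator row, its defect `E′ = M_h(S(V) − S(𝟙))S(𝟙)⁻¹M_χ` and the local identity `M_hS(V)S(𝟙)⁻¹M_χ = M_h + E′`, ABSTRACTLY (dag-n15-c g28, n15-c∕299c)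

Cell `pub-ymgap`, seat `pub-ymgap-dag-n15-c` (generation g28; R134 (a), s1; HUMAN RULING D-0062).  `bears_on: R4∕N15 · K3⁸ SpineGivenEndpointR13SepCoPHV (stmt-QuantumFields-27366)`;
filed `--kind proof --supports stmt-QuantumFields-27366 --as helper` — COUNT-NEUTRAL.  0 `def`, 0 `sorry`; block-majorant bookkeeping on an ABSTRACT carrier.  Imports n15-c∕261
`…PerCubeGreenRows` (`hasMaj_comp_mulOp_cut`, `hasMaj_mulOp_cut_comp`), n15-c∕297 `…TwoSpacingGluingSopLocality` (`hasMaj_nfW_comp_exp`), FILE 56 `…TwoSpacingGluingNonlocal`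
(`hasMaj_commOp_nonlocal`; through it FILE 45's `commOp`, `mulOp`), [B11] `hasMaj_comp_exp`.  Nothing in the tree is modified.

WHY ((PC-B), [B9] (3.95)–(3.96) p.411: «Q′G′²Q′*C₀ = I − R, C₀ = Σ_□ h_□C_□h_□ … (Q′G′²Q′*)⁻¹ = C₀(I − R)⁻¹»).  dag-n15-w2's FILE 46 `glued_inverse_of_localGauges` glues a two-sided inverse of a
GLOBAL operator `Δ` from per-cube local parametrices `G′_k` of the LOCAL operators `Δ^{W_k} = M_{W_k}ΔM_{W_kᵀ}` given (a) cut rows `M_χG′_k ≤ 1_S1_Sβe^{−δd}`, (b) commutator rows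
`[Δ^{W_k}, M_{h_k}]G′_k ≤ 1_S(y′)θ₀e^{−δd}`, (c) defect rows `E′_k ≤ 1_S(y)εe^{−δd}` and (d) the identities `M_{h_k}Δ^{W_k}G′_k = M_{h_k} + E′_k`, with `θ₀ + ε` SMALL.  For `Δ = Q′G′²Q′ᵀ(U)`
on the coarse coloured scalars and the cube's (3.35) gauge, `Δ^{W_k} = S(V_k)` (`V_k = U^{w_k}`, n15-c∕198 `cSop_gauge`) and THIS FILE supplies (a)–(d) for the FLAT LOCAL MODEL
`G′_k := S(𝟙)⁻¹M_{χ_k}`, ABSTRACTLY in: a right inverse `A₁A₁⁻¹ = 1` with row `Ce^{−δd}` (n15-c∕222b: `C = C_S n^{d+1}`), the commutator row `[A, M_h] ≤ θe^{−δd}` (FILE 56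
`hasMaj_commOp_nonlocal`: `θ = O(ℓ) = O(w⁻¹)·n^{−(d+1)}`, ★ `hasMaj_commOp_blockLipschitz₀` here), and the closeness `A − A₁ ≤ (s + fe^{−cd_Z(y)})·be^{−δd}` (n15-c∕299a) read on
`supp h ⊆ {d_Z ≥ marg}` (n15-c∕299b): ★ `localModel_hloc` (d), ★ `localModel_cutRow` (a), ★★ `localModel_commRow` (b), ★★ `localModel_defectRow` (c: `ε = (s + fe^{−c·marg})·bCc_r`).

HONEST FRAMING ∕ LIMITS.  Abstract bookkeeping; [B9] cited for SHAPES ∕ MECHANISM only.  NE2⁺ NOT PRINTED, NOT proved; N15 of record untouched; K3⁸ OPEN; counts UNMOVED.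
Restate-immune (no Theses import).
-/

noncomputable section

open scoped BigOperators

namespace Summit.QuantumFields.YangMills.BalabanUVNodes.N15.Gluing

open Real
open Literature.MathematicalPhysics.QuantumFieldTheory.Balaban1983to89
open Literature.MathematicalPhysics.QuantumFieldTheory.Balaban1983to89.B11SectG (BlockNorm HasMaj RowSum)
open Literature.MathematicalPhysics.QuantumFieldTheory.Balaban1983to89.B6RandomWalk (Triangle254)
open Literature.MathematicalPhysics.QuantumFieldTheory.Balaban1983to89.B6Prop26Gluing (mulOp mulOp_apply ind ind_nonneg ind_le_one)

variable {d : ℕ}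

section LocalModel

variable {Y : Type} [Fintype Y] {g : B6.Geometry} (blk : Y → g.Site) {σ cr : ℝ}
variable {A A₁ Ainv : (Y → ℝ) →ₗ[ℝ] (Y → ℝ)} {h χ : Y → ℝ} {S : Set g.Site}

omit [Fintype Y] in
/-- ★ **THE LOCAL IDENTITY OF THE FLAT MODEL**: `A₁A₁⁻¹ = 1` and `M_hM_χ = M_h` ⟹ `M_h∘A∘(A₁⁻¹M_χ) = M_h + M_h∘(A − A₁)∘A₁⁻¹M_χ` — FILE 46's `hloc'` with the defect
`E′ := M_h(A − A₁)A₁⁻¹M_χ`. [cite: Balaban1985BackgroundPropagators, (3.95)–(3.96) p.411 (shape: `β′G′²β′*C₀ = I − R`)] -/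
theorem localModel_hloc (hinv : A₁ ∘ₗ Ainv = LinearMap.id) (hcut : mulOp h ∘ₗ mulOp χ = mulOp h) :
    mulOp h ∘ₗ A ∘ₗ (Ainv ∘ₗ mulOp χ) = mulOp h + mulOp h ∘ₗ ((A - A₁) ∘ₗ (Ainv ∘ₗ mulOp χ)) := by
  have h0 : A₁ ∘ₗ (Ainv ∘ₗ mulOp χ) = mulOp χ := by rw [← LinearMap.comp_assoc, hinv, LinearMap.id_comp]
  have h1 : A ∘ₗ (Ainv ∘ₗ mulOp χ) = mulOp χ + (A - A₁) ∘ₗ (Ainv ∘ₗ mulOp χ) := by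
    rw [LinearMap.sub_comp, h0]; abel
  rw [h1, LinearMap.comp_add, hcut]

/-- ★ **THE CUT ROW OF THE FLAT MODEL**: `A₁⁻¹ ≤ Ce^{−δd}`, `|χ| ≤ 1` supported over `S` ⟹ `M_χ∘(A₁⁻¹M_χ) ≤ 1_S(y)1_S(y′)·C·e^{−δd}`. [cite: Balaban1985BackgroundPropagators, (3.87) p.409, (3.95) p.411 (shape)] -/
theorem localModel_cutRow {C δ : ℝ} (hC : 0 ≤ C) (hχ1 : ∀ p, |χ p| ≤ 1) (hχS : ∀ p, χ p ≠ 0 → blk p ∈ S)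
    (hAinv : HasMaj (BlockNorm.ofBlocks g blk) (BlockNorm.ofBlocks g blk) Ainv (fun y y' => C * Real.exp (-(δ * g.dist y y')))) :
    HasMaj (BlockNorm.ofBlocks g blk) (BlockNorm.ofBlocks g blk) (mulOp χ ∘ₗ (Ainv ∘ₗ mulOp χ))
      (fun y y' => ind S y * ind S y' * (C * Real.exp (-(δ * g.dist y y')))) := by
  have h1 := hasMaj_comp_mulOp_cut blk (fun y y' => mul_nonneg hC (Real.exp_nonneg _)) hχ1 hχS hAinv
  have h2 := hasMaj_mulOp_cut_comp blk (fun y y' => mul_nonneg (ind_nonneg S y') (mul_nonneg hC (Real.exp_nonneg _))) hχ1 hχS h1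
  exact h2.mono fun y y' => le_of_eq (by ring)

/-- ★ **THE BLOCK-LIPSCHITZ COMMUTATOR with NO oscillation** (FILE 56 `hasMaj_commOp_nonlocal` at `ω = 0`, for a block-constant `h = h̄∘blk`): `|h̄(y) − h̄(y′)| ≤ ℓ|y − y′|`, `A ≤ ce^{−δd}`
⟹ `[A, M_h] ≤ ℓ(eε)⁻¹c·e^{−(δ−ε)d}`. [cite: Balaban1984PropagatorsI, (1.126)–(1.128) p.38 (mechanism)] -/
theorem hasMaj_commOp_blockLipschitz₀ {c δ ℓ ε : ℝ} {hb : g.Site → ℝ} (hc : 0 ≤ c) (hℓ : 0 ≤ ℓ) (hε : 0 < ε) (hd : ∀ y y', 0 ≤ g.dist y y')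
    (hsymm : ∀ y y', g.dist y y' = g.dist y' y) (hLip : ∀ y y', |hb y - hb y'| ≤ ℓ * g.dist y y') (hh : ∀ p, h p = hb (blk p))
    (hA : HasMaj (BlockNorm.ofBlocks g blk) (BlockNorm.ofBlocks g blk) A (fun y y' => c * Real.exp (-(δ * g.dist y y')))) :
    HasMaj (BlockNorm.ofBlocks g blk) (BlockNorm.ofBlocks g blk) (commOp A h) (fun y y' => ℓ * (Real.exp 1 * ε)⁻¹ * c * Real.exp (-((δ - ε) * g.dist y y'))) := by
  have h0 := hasMaj_commOp_nonlocal blk (h := h) (ω := 0) hc hℓ le_rfl hε hd hsymm hLip (fun p => by rw [hh p, sub_self, abs_zero]) hA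
  exact h0.mono fun y y' => le_of_eq (by ring)

/-- ★★ **THE COMMUTATOR ROW OF THE FLAT MODEL**: `[A, M_h] ≤ θe^{−ρ₁d}`, `A₁⁻¹ ≤ Ce^{−ρ₂d}`, `ρ + σ ≤ ρ₁`, `ρ ≤ ρ₂` ⟹ `[A, M_h]∘(A₁⁻¹M_χ) ≤ 1_S(y′)·(κθCc_r)·e^{−ρd}`.
[cite: Balaban1985BackgroundPropagators, (3.95)–(3.96) p.411 (shape: the commutator terms of `R`); Balaban1984PropagatorsII, (2.93) p.239] -/
theorem localModel_commRow (htri : Triangle254 g) (hd : ∀ a b : g.Site, 0 ≤ g.dist a b) (hrow : RowSum g σ cr) {θ C ρ ρ₁ ρ₂ : ℝ} (hθ : 0 ≤ θ) (hC : 0 ≤ C)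
    (hρ : 0 ≤ ρ) (hρ₂ : ρ ≤ ρ₂) (hρ₁ : ρ + σ ≤ ρ₁) (hχ1 : ∀ p, |χ p| ≤ 1) (hχS : ∀ p, χ p ≠ 0 → blk p ∈ S)
    (hK : HasMaj (BlockNorm.ofBlocks g blk) (BlockNorm.ofBlocks g blk) (commOp A h) (fun y y' => θ * Real.exp (-(ρ₁ * g.dist y y'))))
    (hAinv : HasMaj (BlockNorm.ofBlocks g blk) (BlockNorm.ofBlocks g blk) Ainv (fun y y' => C * Real.exp (-(ρ₂ * g.dist y y')))) :
    HasMaj (BlockNorm.ofBlocks g blk) (BlockNorm.ofBlocks g blk) (commOp A h ∘ₗ (Ainv ∘ₗ mulOp χ))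
      (fun y y' => ind S y' * ((BlockNorm.ofBlocks g blk).κ * θ * C * cr * Real.exp (-(ρ * g.dist y y')))) := by
  have h1 := hasMaj_comp_mulOp_cut blk (fun y y' => mul_nonneg hC (Real.exp_nonneg _)) hχ1 hχS hAinv
  exact hasMaj_comp_inLoc S htri hd hrow hθ hC hρ hρ₂ hρ₁ hK h1

/-- ★★ **THE DEFECT ROW OF THE FLAT MODEL**: `A − A₁ ≤ (s + fe^{−cd_Z(y)})·be^{−ρ₁d}` (the closeness, weighted at the OUTPUT), `A₁⁻¹ ≤ Ce^{−ρ₂d}`, `|h| ≤ 1` supported over `S ∩ {d_Z ≥ marg}`,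
`|χ| ≤ 1` ⟹ `E′ = M_h(A − A₁)A₁⁻¹M_χ ≤ 1_S(y)·((s + fe^{−c·marg})·κbCc_r)·e^{−ρd}` — SMALL when the data are close (`s`) and the margin is large.
[cite: Balaban1985BackgroundPropagators, (3.95)–(3.96) p.411, Cor. 3.8 p.410 (shape ∕ mechanism)] -/
theorem localModel_defectRow (htri : Triangle254 g) (hd : ∀ a b : g.Site, 0 ≤ g.dist a b) (hrow : RowSum g σ cr) {dZ : g.Site → ℝ} {s f c b C marg ρ ρ₁ ρ₂ : ℝ}
    (hcr : 0 ≤ cr) (hs : 0 ≤ s) (hf : 0 ≤ f) (hc : 0 ≤ c) (hb : 0 ≤ b) (hC : 0 ≤ C) (hρ : 0 ≤ ρ) (hρ₂ : ρ ≤ ρ₂) (hρ₁ : ρ + σ ≤ ρ₁)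
    (hh1 : ∀ p, |h p| ≤ 1) (hhS : ∀ p, h p ≠ 0 → blk p ∈ S ∧ marg ≤ dZ (blk p)) (hχ1 : ∀ p, |χ p| ≤ 1)
    (hD : HasMaj (BlockNorm.ofBlocks g blk) (BlockNorm.ofBlocks g blk) (A - A₁) (fun y y' => (s + f * Real.exp (-(c * dZ y))) * (b * Real.exp (-(ρ₁ * g.dist y y')))))
    (hAinv : HasMaj (BlockNorm.ofBlocks g blk) (BlockNorm.ofBlocks g blk) Ainv (fun y y' => C * Real.exp (-(ρ₂ * g.dist y y')))) :
    HasMaj (BlockNorm.ofBlocks g blk) (BlockNorm.ofBlocks g blk) (mulOp h ∘ₗ ((A - A₁) ∘ₗ (Ainv ∘ₗ mulOp χ)))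
      (fun y y' => ind S y * (((s + f * Real.exp (-(c * marg))) * ((BlockNorm.ofBlocks g blk).κ * b * C * cr)) * Real.exp (-(ρ * g.dist y y')))) := by
  have hκ := (BlockNorm.ofBlocks g blk).κ_nonneg
  -- `A₁⁻¹M_χ ≤ Ce^{−ρ₂d}` (the indicator dropped)
  have h1 : HasMaj (BlockNorm.ofBlocks g blk) (BlockNorm.ofBlocks g blk) (Ainv ∘ₗ mulOp χ) (fun y y' => C * Real.exp (-(ρ₂ * g.dist y y'))) :=
    (hasMaj_comp_mulOp_cut blk (fun y y' => mul_nonneg hC (Real.exp_nonneg _)) hχ1 (S := Set.univ) (fun p _ => Set.mem_univ _) hAinv).mono fun y y' =>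
      mul_le_of_le_one_left (mul_nonneg hC (Real.exp_nonneg _)) (ind_le_one _ _)
  have h2 := hasMaj_nfW_comp_exp (u := fun y => s + f * Real.exp (-(c * dZ y))) htri hd hrow (fun y => by positivity) hb hC hρ hρ₂ hρ₁ hD h1
  have h3 := hasMaj_mulOp_cut_comp blk (S := {y | y ∈ S ∧ marg ≤ dZ y}) (fun y y' => by positivity) hh1 (fun p hp => hhS p hp) h2
  refine h3.mono fun y y' => ?_
  by_cases hy : y ∈ S ∧ marg ≤ dZ y
  · have hi : ind {y | y ∈ S ∧ marg ≤ dZ y} y = 1 := by simp [ind, hy]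
    have hi' : ind S y = 1 := by simp [ind, hy.1]
    rw [hi, hi', one_mul, one_mul]
    have hexp : Real.exp (-(c * dZ y)) ≤ Real.exp (-(c * marg)) := Real.exp_le_exp.2 (by nlinarith [hy.2])
    have hK0 : 0 ≤ (BlockNorm.ofBlocks g blk).κ * b * C * cr * Real.exp (-(ρ * g.dist y y')) := by positivity
    calc (s + f * Real.exp (-(c * dZ y))) * ((BlockNorm.ofBlocks g blk).κ * b * C * cr * Real.exp (-(ρ * g.dist y y')))
        ≤ (s + f * Real.exp (-(c * marg))) * ((BlockNorm.ofBlocks g blk).κ * b * C * cr * Real.exp (-(ρ * g.dist y y'))) :=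
          mul_le_mul_of_nonneg_right (by nlinarith [hexp]) hK0
      _ = _ := by ring
  · have hi : ind {y | y ∈ S ∧ marg ≤ dZ y} y = 0 := by simp only [ind, Set.mem_setOf_eq]; rw [if_neg hy]
    rw [hi, zero_mul]
    exact mul_nonneg (ind_nonneg _ _) (by positivity)

end LocalModel

end Summit.QuantumFields.YangMills.BalabanUVNodes.N15.Gluing

end
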